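import Summits.BirchSwinnertonDyer.BirchSwinnertonDyer.Theorems.GenusKolyvaginAtTwoTorsionCellD0ParityLocal
import HarnessLib

/-!
# SEL (iso-class Selmer pair law), C1-P: a class relaxed at `∞` only is positive (no Poitou–Tate)

Crux R″ `RankOneTwoTorsionResidualAtTwo` (stmt-27478), LINE 49 «full_vertex», SUPPORT stub SEL
`IsoClassSelmerPairLawAtTwo`, the `C₁` conjunct (LEAD memo `Cruxes/…/Lines/torsion_cell_full_vertex_SEL_C1_road_g36.md`,
§2 (R1)).  For a curve `E/ℚ` with rational `2`-torsion `e₁ < e₂ < e₃`, root differences units off `S ∋ 2`, and a class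
`c ∈ H¹(ℚ, E[2])` with components `a, b` having EVEN valuation at every prime outside `S` and satisfying `E`'s local
Selmer condition at every prime of `S` (nothing required at `∞`):

* `sum_descentFormBits_infty_eq_zero` — the bit of the Hilbert-symbol Tate form at `∞` vanishes:
  `s(a)s(b) + s(a)s(D₂) + s(b)s(D₁) = 0` (Hilbert reciprocity for the form + vanishing at `S` and at unit primes;
  the `out = ∅` case of `…D0ParityLocal.sum_descentFormBits_out_eq_zero`);
* **`pos_of_relaxed_pair`** — if moreover the class with components `(a·D₁, b·δ₁₂)` (= `c + κ(T₁)`) is of the same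
  kind, then `a > 0`.  Consequence (parts C1-F/G): the `∞`-relaxed Selmer group of `E` equals `Sel⁽²⁾(E)`, and the
  reciprocity constraints that PIN the extra relaxed class `z` of the bordered road — in print a piece of Poitou–Tate
  duality (Klagsbrun–Mazur–Rubin Thm. 3.9), here two lines of bits.

Everything is proved; no LINE 49 statement is restated; BSD is not advanced by this file alone.

## References

* [KlagsbrunMazurRubin2013] Z. Klagsbrun, B. Mazur, K. Rubin, Ann. of Math. 178 (2013), Def. 3.3, Thm. 3.9.
* [Serre1973] J.-P. Serre, *A Course in Arithmetic*, Ch. III §1.2 Thm. 1, §2.1 Thm. 3.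
* [SilvermanAEC2009] J. H. Silverman, *The Arithmetic of Elliptic Curves*, 2nd ed., Prop. X.1.4, Prop. X.4.9.
-/

noncomputable section

open scoped Classical

namespace Summit.BirchSwinnertonDyer.BirchSwinnertonDyer.Theorems.GenusKolyvaginAtTwo.TorsionCellSEL

open WeierstrassCurve WeierstrassCurve.Affine WeierstrassCurve.Affine.Point
open Literature.NumberTheory.GaloisRepresentations Literature.NumberTheory.EllipticCurves Field
open Literature.NumberTheory.EllipticCurves.TwoDescentLocal
open Literature.NumberTheory.EllipticCurves.KramerTwoDescent
open Literature.NumberTheory.QuadraticForms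
open Summit.BirchSwinnertonDyer.BirchSwinnertonDyer.Theorems.GenusKolyvaginAtTwo.TorsionCellD0
open IsDedekindDomain NumberField Rat.HeightOneSpectrum

variable (E : WeierstrassCurve ℚ) [E.IsElliptic] {e₁ e₂ e₃ : ℚ} (S : Finset ℕ)

/-- **The form bit at `∞` of a class relaxed at `∞` vanishes**: `s(a)s(b) + s(a)s(D₂) + s(b)s(D₁) = 0` for a class with
components supported on `S` satisfying `E`'s local condition at the primes of `S`.
[cite: KlagsbrunMazurRubin2013, Def. 3.3, Thm. 3.9] [cite: Serre1973, Ch. III §2.1 Thm. 3] -/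
theorem sum_descentFormBits_infty_eq_zero (h : E.toAffine.SplitTwoTorsion e₁ e₂ e₃) (h2S : 2 ∈ S)
    (hgood : ∀ ℓ : ℕ, (hℓ : ℓ.Prime) → ℓ ∉ S → haveI : Fact ℓ.Prime := ⟨hℓ⟩;
      padicValRat ℓ (e₁ - e₂) = 0 ∧ padicValRat ℓ (e₁ - e₃) = 0 ∧ padicValRat ℓ (e₂ - e₃) = 0)
    {c : galH1Torsion E 2} (a b : ℚˣ)
    (ha : kummerEquiv ℚ 2 (E.twoTorsionCharH1 h c) = Additive.ofMul (QuotientGroup.mk a))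
    (hb : kummerEquiv ℚ 2 (E.twoTorsionCharH1 h.swap₁₂ c) = Additive.ofMul (QuotientGroup.mk b))
    (hsupp : ∀ ℓ : ℕ, (hℓ : ℓ.Prime) → ℓ ∉ S → haveI : Fact ℓ.Prime := ⟨hℓ⟩;
      parityBit ℓ (a : ℚ) = 0 ∧ parityBit ℓ (b : ℚ) = 0)
    (hloc : ∀ v : HeightOneSpectrum (𝓞 ℚ), natGenerator v ∈ S → c ∈ selmerLocalKer E (v.adicCompletion ℚ) 2) :
    signBit (a : ℚ) * signBit (b : ℚ) + signBit (a : ℚ) * signBit ((e₂ - e₁) * (e₂ - e₃)) +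
      signBit (b : ℚ) * signBit ((e₁ - e₂) * (e₁ - e₃)) = 0 := by
  -- integral representatives of the four square classes
  obtain ⟨A, ca, hA0, hca, hA⟩ := Rat.exists_mul_sq_eq_intCast a.ne_zero
  obtain ⟨B, cb, hB0, hcb, hB⟩ := Rat.exists_mul_sq_eq_intCast b.ne_zero
  obtain ⟨D₁', c₁, hD₁0, hc₁, hD₁⟩ := Rat.exists_mul_sq_eq_intCast h.c_ne_zero
  obtain ⟨D₂', c₂, hD₂0, hc₂, hD₂⟩ := Rat.exists_mul_sq_eq_intCast h.swap₁₂.c_ne_zero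
  have hN : 2 * A * B * D₁' * D₂' ≠ 0 :=
    mul_ne_zero (mul_ne_zero (mul_ne_zero (mul_ne_zero two_ne_zero hA0) hB0) hD₁0) hD₂0
  set f : ℕ → ℤ := fun ℓ => localSign ℓ A B * localSign ℓ A D₂' * localSign ℓ B D₁' with hf
  -- (1) `f ℓ = 1` for every prime `ℓ`
  have hf1 : ∀ ℓ : ℕ, ℓ.Prime → f ℓ = 1 := by
    intro ℓ hℓ
    haveI : Fact ℓ.Prime := ⟨hℓ⟩
    by_cases hℓS : ℓ ∈ S
    · set v : HeightOneSpectrum (𝓞 ℚ) := (primesEquiv (R := 𝓞 ℚ)).symm ⟨ℓ, hℓ⟩ with hv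
      have hgen : natGenerator v = ℓ :=
        congrArg Subtype.val ((primesEquiv (R := 𝓞 ℚ)).apply_symm_apply ⟨ℓ, hℓ⟩)
      have := localSign_descentForm_eq_one_of_mem_selmerLocalKer E h v (hloc v (hgen ▸ hℓS)) a b ha hb hca hcb hc₁ hc₂
        hA hB hD₁ hD₂
      rwa [hgen] at this
    · have hℓ2 : ℓ ≠ 2 := fun h2 => hℓS (h2 ▸ h2S)
      obtain ⟨hpa, hpb⟩ := hsupp ℓ hℓ hℓS
      obtain ⟨g12, g13, g23⟩ := hgood ℓ hℓ hℓS
      have heA := even_padicValInt_of_parityBit_eq_zero (ℓ := ℓ) ((bits_eq_of_mul_sq_eq (ℓ := ℓ) a.ne_zero hca hA).1 ▸ hpa)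
      have heB := even_padicValInt_of_parityBit_eq_zero (ℓ := ℓ) ((bits_eq_of_mul_sq_eq (ℓ := ℓ) b.ne_zero hcb hB).1 ▸ hpb)
      have hpD₁ : parityBit ℓ ((e₁ - e₂) * (e₁ - e₃)) = 0 := by
        rw [parityBit, padicValRat.mul (sub_ne_zero.mpr h.ne₁₂) (sub_ne_zero.mpr h.ne₁₃), g12, g13, add_zero, Int.cast_zero]
      have hpD₂ : parityBit ℓ ((e₂ - e₁) * (e₂ - e₃)) = 0 := by
        rw [parityBit, padicValRat.mul (sub_ne_zero.mpr h.ne₁₂.symm) (sub_ne_zero.mpr h.ne₂₃),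
          show e₂ - e₁ = -(e₁ - e₂) by ring, padicValRat.neg, g12, g23, add_zero, Int.cast_zero]
      have heD₁ := even_padicValInt_of_parityBit_eq_zero (ℓ := ℓ) ((bits_eq_of_mul_sq_eq (ℓ := ℓ) h.c_ne_zero hc₁ hD₁).1 ▸ hpD₁)
      have heD₂ := even_padicValInt_of_parityBit_eq_zero (ℓ := ℓ)
        ((bits_eq_of_mul_sq_eq (ℓ := ℓ) h.swap₁₂.c_ne_zero hc₂ hD₂).1 ▸ hpD₂)
      show localSign ℓ A B * localSign ℓ A D₂' * localSign ℓ B D₁' = 1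
      rw [localSign_eq_one_of_even hℓ2 hA0 hB0 heA heB, localSign_eq_one_of_even hℓ2 hA0 hD₂0 heA heD₂,
        localSign_eq_one_of_even hℓ2 hB0 hD₁0 heB heD₁]
      norm_num
  -- (2) reciprocity
  have hrec := prod_localSign_descentForm_eq_one hA0 hB0 hD₁0 hD₂0
  have hprod : ∏ ℓ ∈ (2 * A * B * D₁' * D₂').natAbs.primeFactors, f ℓ = 1 :=
    Finset.prod_eq_one fun ℓ hℓ => hf1 ℓ (Nat.prime_of_mem_primeFactors hℓ)
  rw [hprod, mul_one] at hrec
  -- (3) in bits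
  haveI : Fact (Nat.Prime 2) := ⟨Nat.prime_two⟩
  obtain ⟨-, -, hsa⟩ := bits_eq_of_mul_sq_eq (ℓ := 2) a.ne_zero hca hA
  obtain ⟨-, -, hsb⟩ := bits_eq_of_mul_sq_eq (ℓ := 2) b.ne_zero hcb hB
  obtain ⟨-, -, hs1⟩ := bits_eq_of_mul_sq_eq (ℓ := 2) h.c_ne_zero hc₁ hD₁
  obtain ⟨-, -, hs2⟩ := bits_eq_of_mul_sq_eq (ℓ := 2) h.swap₁₂.c_ne_zero hc₂ hD₂
  rw [localSignInfty_eq_neg_one_pow_signBit, localSignInfty_eq_neg_one_pow_signBit,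
    localSignInfty_eq_neg_one_pow_signBit, ← neg_one_pow_val_add, ← neg_one_pow_val_add, neg_one_pow_val_eq_one_iff] at hrec
  rw [hsa, hsb, hs1, hs2]
  linear_combination hrec

/-- `𝔽₂`: `xy + x = 0` and `xy = 0` force `x = 0`. [folklore] -/
private theorem zmod2_pair (x y : ZMod 2) (h1 : x * y + x = 0) (h2 : x * y = 0) : x = 0 := by
  revert x y h1 h2; decide

/-- **A class relaxed at `∞` is positive** (R_S = torsion, no Poitou–Tate): with `e₁ < e₂ < e₃`, if both the class `c`
with components `(a, b)` and the class `c'` with components `(a·D₁, b·δ₁₂)` (`= c + κ(T₁)`) are supported on `S` and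
satisfy `E`'s local condition at the primes of `S`, then `a > 0` — the form bits at `∞` of `c` and `c'` are
`s(a)s(b) + s(a)` and `s(a)s(b)`.  [cite: KlagsbrunMazurRubin2013, Thm. 3.9] [cite: SilvermanAEC2009, Prop. X.1.4] -/
theorem pos_of_relaxed_pair (h : E.toAffine.SplitTwoTorsion e₁ e₂ e₃) (h12 : e₁ < e₂) (h23 : e₂ < e₃) (h2S : 2 ∈ S)
    (hgood : ∀ ℓ : ℕ, (hℓ : ℓ.Prime) → ℓ ∉ S → haveI : Fact ℓ.Prime := ⟨hℓ⟩;
      padicValRat ℓ (e₁ - e₂) = 0 ∧ padicValRat ℓ (e₁ - e₃) = 0 ∧ padicValRat ℓ (e₂ - e₃) = 0)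
    {c c' : galH1Torsion E 2} (a b a' b' : ℚˣ)
    (ha : kummerEquiv ℚ 2 (E.twoTorsionCharH1 h c) = Additive.ofMul (QuotientGroup.mk a))
    (hb : kummerEquiv ℚ 2 (E.twoTorsionCharH1 h.swap₁₂ c) = Additive.ofMul (QuotientGroup.mk b))
    (ha' : kummerEquiv ℚ 2 (E.twoTorsionCharH1 h c') = Additive.ofMul (QuotientGroup.mk a'))
    (hb' : kummerEquiv ℚ 2 (E.twoTorsionCharH1 h.swap₁₂ c') = Additive.ofMul (QuotientGroup.mk b'))
    (haa' : (a' : ℚ) = a * ((e₁ - e₂) * (e₁ - e₃))) (hbb' : (b' : ℚ) = b * (e₁ - e₂))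
    (hsupp : ∀ ℓ : ℕ, (hℓ : ℓ.Prime) → ℓ ∉ S → haveI : Fact ℓ.Prime := ⟨hℓ⟩;
      parityBit ℓ (a : ℚ) = 0 ∧ parityBit ℓ (b : ℚ) = 0)
    (hsupp' : ∀ ℓ : ℕ, (hℓ : ℓ.Prime) → ℓ ∉ S → haveI : Fact ℓ.Prime := ⟨hℓ⟩;
      parityBit ℓ (a' : ℚ) = 0 ∧ parityBit ℓ (b' : ℚ) = 0)
    (hloc : ∀ v : HeightOneSpectrum (𝓞 ℚ), natGenerator v ∈ S → c ∈ selmerLocalKer E (v.adicCompletion ℚ) 2)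
    (hloc' : ∀ v : HeightOneSpectrum (𝓞 ℚ), natGenerator v ∈ S → c' ∈ selmerLocalKer E (v.adicCompletion ℚ) 2) :
    0 < (a : ℚ) := by
  have e1 := sum_descentFormBits_infty_eq_zero E S h h2S hgood a b ha hb hsupp hloc
  have e2 := sum_descentFormBits_infty_eq_zero E S h h2S hgood a' b' ha' hb' hsupp' hloc'
  -- signs of the root differences
  have hD₁ : signBit ((e₁ - e₂) * (e₁ - e₃)) = 0 :=
    (signBit_eq_zero_iff h.c_ne_zero).mpr (mul_pos_of_neg_of_neg (sub_neg.mpr h12) (sub_neg.mpr (h12.trans h23)))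
  have hD₂ : signBit ((e₂ - e₁) * (e₂ - e₃)) = 1 := by
    unfold signBit; rw [if_pos (mul_neg_of_pos_of_neg (sub_pos.mpr h12) (sub_neg.mpr h23))]
  have hδ : signBit (e₁ - e₂) = 1 := by unfold signBit; rw [if_pos (sub_neg.mpr h12)]
  have hsa' : signBit (a' : ℚ) = signBit (a : ℚ) := by
    rw [haa', signBit_mul a.ne_zero h.c_ne_zero, hD₁, add_zero]
  have hsb' : signBit (b' : ℚ) = signBit (b : ℚ) + 1 := by
    rw [hbb', signBit_mul b.ne_zero (sub_ne_zero.mpr h.ne₁₂), hδ]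
  rw [hD₁, hD₂] at e1 e2
  rw [hsa', hsb'] at e2
  refine (signBit_eq_zero_iff a.ne_zero).mp (zmod2_pair _ (signBit (b : ℚ)) ?_ ?_)
  · linear_combination e1
  · linear_combination (norm := ring_nf) e2
    rw [show (2 : ZMod 2) = 0 by decide]; ring

end Summit.BirchSwinnertonDyer.BirchSwinnertonDyer.Theorems.GenusKolyvaginAtTwo.TorsionCellSEL

end
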